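import Summits.BirchSwinnertonDyer.BirchSwinnertonDyer.Theorems.GoldfeldAllTwistsTwoConverseTwinSplitSecondHalvingFrame
import Summits.BirchSwinnertonDyer.BirchSwinnertonDyer.Theorems.GoldfeldAllTwistsTwoConverseTwinGenusSecondHalving
import Summits.BirchSwinnertonDyer.BirchSwinnertonDyer.Theorems.GoldfeldAllTwistsTwoConverseTwinInertSevenSplitSymbolFamilies
import Summits.BirchSwinnertonDyer.BirchSwinnertonDyer.Theorems.GoldfeldAllTwistsTwoConverseTwinAdditiveInertTwistSelmer
import Summits.BirchSwinnertonDyer.BirchSwinnertonDyer.Theorems.GoldfeldAllTwistsTwoConverseTwinAdditiveTorsion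
import Literature.NumberTheory.EllipticCurves.TwoIsogenyDescentIndex
import Literature.NumberTheory.EllipticCurves.TwoIsogenySelmerGroupRankProofs
import Literature.NumberTheory.EllipticCurves.StrictSelmerRankOne
import HarnessLib

set_option linter.dupNamespace false -- `…BirchSwinnertonDyer.BirchSwinnertonDyer…` is the cell's namespace (D-0017)
set_option autoImplicit false

/-!
# Twin″ (item 19140), LINE U″ — the closing `2`-descent coordinates, I (FACT-FREE ALGEBRA over `ℚ` and any field `A ⊇ ℚ`):
# the abscissa of the twist substitution `Φ_t`, the `x`-square class of a GENERATOR of `E_{a,b}(ℚ)` in rank one, `S(−ℓ)`, torsion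

Cell `bsd-goldfeld`, seat `bsd-goldfeld-s1p-c301` (prover; written gen 15, filed gen 16 on planner ORDER (ccxxx)/(ccxxxv)/(ccxxxvii) «LINE U″»,
file A of the announced three A → C → F: A = this algebra, C = `…TwinSplitSecondHalvingClasses`, F = `…TwinSplitSecondHalvingFinal`).
Support for `stmt-BirchSwinnertonDyer-19140` (twin″); Theses-free; theorems only; no `sorry`, no definition, no named fact. HONEST FRAMING:
elementary algebra of Weierstrass models and of the `2`-isogeny descent map `α = xSqClass` (Silverman–Tate §3.5–3.6); nothing about `L`-values;
no case of twin″ or of BSD is decided.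

* §1 `sq_u_sqChange_cm7_and_r`: the completed-square change `sqChange cm7` (a `Classical.choose`) has `u² = 1`, `r = 0` (solve
  `C • cm7 = cm7^{(1)}` coefficient-wise: `s = −½`, `t = −r/2`, `4r = 1 − u²`, `35u⁴ = 35`); hence **`x_twistPointEquivOver_incl_some`**: the
  abscissa of `Φ_t(ι(X, Y))` is `t⁻²·X` (`Φ_t : X₀(49)^{(c)}(A) ≃ X₀(49)(A)`, `t² = c`).
* §2 `xSqClass_generator_ne` — for `E = [0,a,0,b,0]/ℚ` of rank `1` with torsion `{O, T}` and `#S′ ≤ 2`: a generator `g` modulo torsion has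
  `α(g) ∉ {1, [b]}` (Silverman–Tate `#α(Γ)·#ᾱ(Γ̄) = 2^{r+2}`: else `#α(Γ) ≤ 2`, `#ᾱ(Γ̄) ≤ 2`).
* §3 `twoIsogenySelmerGroup_negSplitPrime_subset` (VIII's `S(−ℓ) ⊆ {1,7,ℓ,2ℓ,7ℓ,14ℓ}`, extracted from the proof of
  `card_twoIsogenySelmerGroup_splitPrimeTwist_le`) and `torsion_twoTorsionModel_cm7` (`E_M(ℚ)_tors = {O, T}`).
* §4 `padicValNat_two_natAbs_mul_two_eq_three_iff`: `ord₂(2|M|) = 3 ⟺ M ∈ 4·(odd)`.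
The two instances (`α_ℚ` of a generator of `49a1^{(−ℓ)}(ℚ)` / `49a1^{(−a)}(ℚ)`) are file C.
References: [SilvermanTate2015] §3.5–3.6; [SilvermanAEC2009] III.1, VII.3, X.4.9, X.5 Cor. 5.4.
-/

noncomputable section

open scoped Classical

open WeierstrassCurve Literature.NumberTheory.EllipticCurves Literature.NumberTheory.EllipticCurves.ModularForms
  Summit.BirchSwinnertonDyer.Rank1Residual.AdditivePotMult
open WeierstrassCurve.Affine (sqClass sqClass_mul sqClass_sq sqClass_eq_one_iff)

namespace Summit.BirchSwinnertonDyer.BirchSwinnertonDyer.Theorems.GoldfeldGoodTwists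

/-! ## §1 The completed-square change of `X₀(49)` and the abscissa of `Φ_t` -/

section Abscissa

/-- **`sqChange cm7` has `u² = 1` and `r = 0`.** Any change `C = (u, r, s, t)` with `C • cm7 = cm7^{(1)} = [0, −3/4, 0, −2, −1]` has
`s = −½` (`a₁`), `4u⁻²(3r − ¾)·… ` i.e. `4r = u² − 1` read through `a₂`, `t = −r/2` (`a₃`), and then `a₄` forces `35u⁻⁸·(u⁴ − 1)·… = 0`, so
`u² = 1` (over `ℚ`) and `r = 0`. [cite: SilvermanAEC2009, III.1 Table 3.1] -/
theorem sq_u_sqChange_cm7_and_r : ((sqChange cm7).u : ℚ) ^ 2 = 1 ∧ (sqChange cm7).r = 0 := by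
  set C := sqChange cm7 with hC
  have h := sqChange_spec cm7
  have h1 := congrArg WeierstrassCurve.a₁ h
  have h2 := congrArg WeierstrassCurve.a₂ h
  have h3 := congrArg WeierstrassCurve.a₃ h
  have h4 := congrArg WeierstrassCurve.a₄ h
  simp only [variableChange_a₁, variableChange_a₂, variableChange_a₃, variableChange_a₄, quadraticTwist_a₁, quadraticTwist_a₂,
    quadraticTwist_a₃, quadraticTwist_a₄, b₂, b₄] at h1 h2 h3 h4
  norm_num at h1 h2 h3 h4
  -- `U = u ≠ 0`; `a₁`: `s = −½`; `a₃`: `t = −r/2`; `a₂`: `4r = 1 − U²`; `a₄`: `35 (U²)² = 35`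
  have hU : (C.u : ℚ) ≠ 0 := C.u.ne_zero
  set v : ℚ := (C.u : ℚ) ^ 2 with hv
  have hv0 : v ≠ 0 := pow_ne_zero _ hU
  have hs : C.s = -1 / 2 := by linarith
  have h3' : C.t = -C.r / 2 := by linarith
  rw [hs] at h2 h4
  rw [h3'] at h4
  rw [inv_mul_eq_iff_eq_mul₀ hv0] at h2
  rw [show (C.u : ℚ) ^ 4 = v ^ 2 by rw [hv]; ring, inv_mul_eq_iff_eq_mul₀ (pow_ne_zero _ hv0)] at h4
  have hr : 4 * C.r = 1 - v := by linarith
  have h4' : 3 * C.r ^ 2 - 3 / 2 * C.r - 2 = v ^ 2 * (-2) := by linarith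
  have hv1 : v ^ 2 = 1 := by linear_combination (16 / 35 : ℚ) * h4' - (3 / 35 : ℚ) * (4 * C.r - 1 - v) * hr
  have hv1' : v = 1 := by
    have hvpos : 0 < v := by rw [hv]; positivity
    nlinarith [hv1, hvpos]
  exact ⟨hv1', by linarith⟩

/-- **The abscissa of the twist substitution.** For `A ⊇ ℚ` a field, `t ∈ A ∖ ℚ` with `t² = c`, and an affine point `(X, Y)` of
`X₀(49)^{(c)}(ℚ)`: `Φ_t(ι(X, Y))` is the affine point of `X₀(49)(A)` with `x`-coordinate **`t⁻² · X`** (step one `(X,Y) ↦ (X/t², Y/t³)` onto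
`X₀(49)^{(1)}`, then un-completing the square by `(sqChange cm7)⁻¹`, which fixes `x` by §1). [cite: SilvermanAEC2009, X.5 Cor. 5.4 and III.1] -/
theorem x_twistPointEquivOver_incl_some {A : Type} [Field A] [CharZero A] {t : A} {c : ℚ}
    (ht : t ∉ Set.range (algebraMap ℚ A)) (htc : t ^ 2 = algebraMap ℚ A c) [(cm7.quadraticTwist c).IsElliptic]
    {X Y : ℚ} (h : (cm7.quadraticTwist c).toAffine.Nonsingular X Y) :
    ∃ yQ hQ, twistPointEquivOver cm7 ht htc (QuadraticDescent.incl A (cm7.quadraticTwist c) (.some X Y h)) =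
      .some (t⁻¹ ^ 2 * algebraMap ℚ A X) yQ hQ := by
  set P := QuadraticDescent.incl A (cm7.quadraticTwist c) (.some X Y h) with hP
  have hPsome : P = .some (algebraMap ℚ A X) (algebraMap ℚ A Y)
      ((Affine.baseChange_nonsingular (W := cm7.quadraticTwist c) (f := Algebra.ofId ℚ A)
        (algebraMap ℚ A).injective X Y).mpr h) := by
    rw [hP]; rfl
  set Q := twistPointEquivOver cm7 ht htc P with hQ
  have hQP : twistStepTwo cm7 (A := A) Q = twistStepOne cm7 ht htc P := by
    rw [hQ, twistPointEquivOver_apply, AddEquiv.apply_symm_apply]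
  rcases hQc : Q with _ | ⟨xQ, yQ, hQ'⟩
  · exfalso
    rw [hQc, hPsome, twistStepOne_some, ← Affine.Point.zero_def, map_zero] at hQP
    exact Affine.Point.some_ne_zero _ hQP.symm
  · rw [hQc, hPsome, twistStepTwo_some, twistStepOne_some] at hQP
    have hx := ((Affine.Point.some.injEq _ _ _ _ _ _).mp hQP).1
    obtain ⟨hu2, hr0⟩ := sq_u_sqChange_cm7_and_r
    have huA : ((((sqChange cm7).map (algebraMap ℚ A)).u⁻¹ : Aˣ) : A) ^ 2 = 1 := by
      rw [Units.val_inv_eq_inv_val, inv_pow]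
      simp only [VariableChange.map, Units.coe_map, MonoidHom.coe_coe]
      rw [← map_pow, hu2, map_one, inv_one]
    have hx' : xQ = t⁻¹ ^ 2 * algebraMap ℚ A X := by
      rw [VariableChange.toX_def, (toX_toY_twistUntwist ht (algebraMap ℚ A X) (algebraMap ℚ A Y)).1, huA, one_mul] at hx
      simpa [VariableChange.map, hr0] using hx
    subst hx'
    exact ⟨yQ, hQ', rfl⟩

end Abscissa

/-! ## §2 The `x`-square class of a generator of `E_{a,b}(ℚ)` in rank one -/

section Generator

/-- **`α(g) ∉ {1, [b]}` for a generator `g` of `E_{a,b}(ℚ)` modulo torsion**, when `rank E_{a,b}(ℚ) = 1`, `E_{a,b}(ℚ)_tors = {O, T}` and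
`#S′(a,b) ≤ 2`: by Silverman–Tate's `#α(Γ)·#ᾱ(Γ̄) = 2^{r+2} = 8` and `#ᾱ(Γ̄) ≤ #S′ ≤ 2` the image `α(Γ)` has `≥ 4` elements, whereas
`α(g) ∈ {1, [b]} = α({O, T})` would give `α(Γ) = α(ℤg + {O,T}) ⊆ {1, [b]}`. [cite: SilvermanTate2015, §3.6 (2^r = #α(Γ)·#ᾱ(Γ̄)/4) and §3.5] -/
theorem xSqClass_generator_ne {a b : ℤ} (hab : b * (a ^ 2 - 4 * b) ≠ 0)
    [hE : (⟨0, (a : ℚ), 0, (b : ℚ), 0⟩ : WeierstrassCurve ℚ).IsElliptic]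
    (hr : (⟨0, (a : ℚ), 0, (b : ℚ), 0⟩ : WeierstrassCurve ℚ).mordellWeilRank = 1)
    (htors : ∀ P : (⟨0, (a : ℚ), 0, (b : ℚ), 0⟩ : WeierstrassCurve ℚ).toAffine.Point, IsOfFinAddOrder P →
      P = 0 ∨ P = (⟨0, (a : ℚ), 0, (b : ℚ), 0⟩ : WeierstrassCurve ℚ).twoTorsionPoint)
    (hS' : (twoIsogenySelmerGroup' a b).card ≤ 2)
    {g : (⟨0, (a : ℚ), 0, (b : ℚ), 0⟩ : WeierstrassCurve ℚ).toAffine.Point}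
    (hgen : ∀ P : (⟨0, (a : ℚ), 0, (b : ℚ), 0⟩ : WeierstrassCurve ℚ).toAffine.Point,
      ∃ (k : ℤ) (t : (⟨0, (a : ℚ), 0, (b : ℚ), 0⟩ : WeierstrassCurve ℚ).toAffine.Point), IsOfFinAddOrder t ∧ P = k • g + t) :
    (⟨0, (a : ℚ), 0, (b : ℚ), 0⟩ : WeierstrassCurve ℚ).xSqClass g ≠ 1 ∧
      (⟨0, (a : ℚ), 0, (b : ℚ), 0⟩ : WeierstrassCurve ℚ).xSqClass g ≠ sqClass (b : ℚ) := by
  -- `#α(Γ) ≥ 4`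
  have hmul := natCard_range_xSqClass_mul (⟨0, (a : ℚ), 0, (b : ℚ), 0⟩ : WeierstrassCurve ℚ)
  rw [hr, show 2 ^ (1 + 2) = 8 by norm_num] at hmul
  have hab' := twoIsogenyCodomain_ne_zero hab
  obtain ⟨-, hc₂⟩ := natCard_range_xSqClass_le hab'
  rw [← twoIsogenyCodomain_mk_intCast a b] at hc₂
  have hc₂' := hc₂.trans hS'
  have h4 : 4 ≤ Nat.card (Set.range (⟨0, (a : ℚ), 0, (b : ℚ), 0⟩ : WeierstrassCurve ℚ).xSqClass) := by
    by_contra hlt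
    push Not at hlt
    nlinarith [hmul, hc₂', hlt]
  -- `α` is multiplicative (the tree's `xSqClass_add`, stated in the classical instance world: bridged by `convert`) and so
  -- `α(n • P) = α(P)^n`, `α` on torsion `⊆ {1, [b]}`
  have hadd : ∀ P Q : (⟨0, (a : ℚ), 0, (b : ℚ), 0⟩ : WeierstrassCurve ℚ).toAffine.Point,
      (⟨0, (a : ℚ), 0, (b : ℚ), 0⟩ : WeierstrassCurve ℚ).xSqClass (P + Q) =
        (⟨0, (a : ℚ), 0, (b : ℚ), 0⟩ : WeierstrassCurve ℚ).xSqClass P * (⟨0, (a : ℚ), 0, (b : ℚ), 0⟩ : WeierstrassCurve ℚ).xSqClass Q :=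
    fun P Q ↦ by convert xSqClass_add (⟨0, (a : ℚ), 0, (b : ℚ), 0⟩ : WeierstrassCurve ℚ) P Q
  have hneg : ∀ P : (⟨0, (a : ℚ), 0, (b : ℚ), 0⟩ : WeierstrassCurve ℚ).toAffine.Point,
      (⟨0, (a : ℚ), 0, (b : ℚ), 0⟩ : WeierstrassCurve ℚ).xSqClass (-P) = (⟨0, (a : ℚ), 0, (b : ℚ), 0⟩ : WeierstrassCurve ℚ).xSqClass P :=
    fun P ↦ by convert xSqClass_neg (⟨0, (a : ℚ), 0, (b : ℚ), 0⟩ : WeierstrassCurve ℚ) P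
  have hinv : ∀ u : Affine.SqUnits ℚ, u⁻¹ = u := fun u ↦ inv_eq_of_mul_eq_one_right (Affine.SqUnits.mul_self u)
  have hαz : ∀ (n : ℤ) (P : (⟨0, (a : ℚ), 0, (b : ℚ), 0⟩ : WeierstrassCurve ℚ).toAffine.Point),
      (⟨0, (a : ℚ), 0, (b : ℚ), 0⟩ : WeierstrassCurve ℚ).xSqClass (n • P) =
        (⟨0, (a : ℚ), 0, (b : ℚ), 0⟩ : WeierstrassCurve ℚ).xSqClass P ^ n := fun n P ↦ by
    induction n using Int.induction_on with
    | zero => rw [zero_zsmul, zpow_zero]; exact xSqClass_zero _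
    | succ k ih => rw [add_zsmul, one_zsmul, hadd, ih, zpow_add_one]
    | pred k ih =>
      rw [sub_zsmul, one_zsmul, sub_eq_add_neg, hadd, hneg, ih, ← sub_eq_add_neg, zpow_sub_one, hinv]
  have hαtors : ∀ t : (⟨0, (a : ℚ), 0, (b : ℚ), 0⟩ : WeierstrassCurve ℚ).toAffine.Point, IsOfFinAddOrder t →
      (⟨0, (a : ℚ), 0, (b : ℚ), 0⟩ : WeierstrassCurve ℚ).xSqClass t = 1 ∨
        (⟨0, (a : ℚ), 0, (b : ℚ), 0⟩ : WeierstrassCurve ℚ).xSqClass t = sqClass (b : ℚ) := by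
    intro t ht
    rcases htors t ht with rfl | rfl
    · exact Or.inl (xSqClass_zero _)
    · exact Or.inr (by rw [xSqClass_twoTorsionPoint])
  -- if `α(g) ∈ {1, [b]}` then `α(Γ) ⊆ {1, [b]}`, of cardinality `≤ 2`
  by_contra hcon
  have hg : (⟨0, (a : ℚ), 0, (b : ℚ), 0⟩ : WeierstrassCurve ℚ).xSqClass g = 1 ∨
      (⟨0, (a : ℚ), 0, (b : ℚ), 0⟩ : WeierstrassCurve ℚ).xSqClass g = sqClass (b : ℚ) := by
    by_cases h1 : (⟨0, (a : ℚ), 0, (b : ℚ), 0⟩ : WeierstrassCurve ℚ).xSqClass g = 1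
    · exact Or.inl h1
    · exact Or.inr (by_contra fun h2 ↦ hcon ⟨h1, h2⟩)
  have hbb : sqClass (b : ℚ) * sqClass (b : ℚ) = 1 := Affine.SqUnits.mul_self _
  have hpow : ∀ n : ℤ, (⟨0, (a : ℚ), 0, (b : ℚ), 0⟩ : WeierstrassCurve ℚ).xSqClass g ^ n = 1 ∨
      (⟨0, (a : ℚ), 0, (b : ℚ), 0⟩ : WeierstrassCurve ℚ).xSqClass g ^ n = sqClass (b : ℚ) := by
    intro n
    rcases hg with h | h <;> rw [h]
    · exact Or.inl (one_zpow n)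
    · rcases Int.even_or_odd n with he | ho
      · exact Or.inl ((sqUnits_zpow_eq _ n).1 he)
      · exact Or.inr ((sqUnits_zpow_eq _ n).2 ho)
  have hsub : Set.range (⟨0, (a : ℚ), 0, (b : ℚ), 0⟩ : WeierstrassCurve ℚ).xSqClass ⊆
      ({1, sqClass (b : ℚ)} : Set (Affine.SqUnits ℚ)) := by
    rintro _ ⟨P, rfl⟩
    obtain ⟨k, t, ht, rfl⟩ := hgen P
    rw [hadd, hαz]
    rcases hpow k with h | h <;> rcases hαtors t ht with h' | h' <;> rw [h, h']
    · exact Or.inl (Affine.SqUnits.one_mul _)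
    · exact Or.inr (Affine.SqUnits.one_mul _)
    · exact Or.inr (Affine.SqUnits.mul_one _)
    · exact Or.inl hbb
  have hle : Nat.card (Set.range (⟨0, (a : ℚ), 0, (b : ℚ), 0⟩ : WeierstrassCurve ℚ).xSqClass) ≤ 2 := by
    refine (Nat.card_mono (Set.toFinite _) hsub).trans ?_
    rw [Nat.card_coe_set_eq]
    exact (Set.ncard_insert_le _ _).trans (by rw [Set.ncard_singleton])
  omega

end Generator

/-! ## §3 The Selmer set `S(−ℓ)` and the torsion of the two-torsion model `E_M` -/

section SelmerTorsion

variable {l : ℕ} [Fact l.Prime]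

/-- For `ℓ ≡ 5 (mod 8)`: `2` is a non-residue (part VIII's private lemma). [folklore] -/
private theorem not_isSquare_two_of_mod_eight' (hl8 : l % 8 = 5) : ¬ IsSquare ((2 : ℤ) : ZMod l) := by
  have hl2 : l ≠ 2 := by rintro rfl; norm_num at hl8
  refine (legendreSym.eq_neg_one_iff l).mp ?_
  rw [legendreSym.at_two hl2, ZMod.χ₈_nat_eq_if_mod_eight]
  simp [hl8, show l % 2 = 1 by omega]

/-- For `ℓ ≡ 5 (mod 8)` split: `14`, `8`, `56` are non-residues mod `ℓ` (part VIII's private lemma). [folklore] -/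
private theorem not_isSquare_fourteen_eight_fiftysix' (hl8 : l % 8 = 5) (hl7 : legendreSym l (-7) = 1) :
    ¬ IsSquare ((14 : ℤ) : ZMod l) ∧ ¬ IsSquare ((8 : ℤ) : ZMod l) ∧ ¬ IsSquare ((56 : ℤ) : ZMod l) := by
  have hl2 : l ≠ 2 := by rintro rfl; norm_num at hl8
  have h2 : legendreSym l 2 = -1 := (legendreSym.eq_neg_one_iff l).mpr (not_isSquare_two_of_mod_eight' hl8)
  have h7 : legendreSym l 7 = 1 := by
    have h1 : legendreSym l (-1) = 1 := by rw [legendreSym.at_neg_one hl2, ZMod.χ₄_nat_one_mod_four (by omega)]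
    have hmul : legendreSym l (-7) = legendreSym l (-1) * legendreSym l 7 := by rw [← legendreSym.mul]; norm_num
    rwa [hmul, h1, one_mul] at hl7
  have h20 : ((2 : ℤ) : ZMod l) ≠ 0 := by
    intro h
    have : ((2 : ℕ) : ZMod l) = 0 := by exact_mod_cast h
    rw [ZMod.natCast_eq_zero_iff] at this
    exact hl2 ((Nat.prime_dvd_prime_iff_eq Fact.out Nat.prime_two).mp this)
  have h4 : legendreSym l 4 = 1 := by
    rw [show (4 : ℤ) = 2 ^ 2 by norm_num]; exact legendreSym.sq_one' l h20
  refine ⟨(legendreSym.eq_neg_one_iff l).mp ?_, (legendreSym.eq_neg_one_iff l).mp ?_, (legendreSym.eq_neg_one_iff l).mp ?_⟩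
  · rw [show (14 : ℤ) = 2 * 7 by norm_num, legendreSym.mul, h2, h7]; norm_num
  · rw [show (8 : ℤ) = 4 * 2 by norm_num, legendreSym.mul, h4, h2]; norm_num
  · rw [show (56 : ℤ) = 4 * (2 * 7) by norm_num, legendreSym.mul, legendreSym.mul, h4, h2, h7]; norm_num

/-- **`S(−ℓ) ⊆ {1, 7, ℓ, 2ℓ, 7ℓ, 14ℓ}`** for `E_{−ℓ} : y² = x³ − 21ℓx² + 112ℓ²x`, `ℓ ≡ 5 (mod 8)` prime, `(−7/ℓ) = +1` — part VIII's
inclusion (proof of `card_twoIsogenySelmerGroup_splitPrimeTwist_le`), extracted verbatim. [cite: SilvermanAEC2009, Prop. X.4.9 and Example X.4.10] -/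
theorem twoIsogenySelmerGroup_negSplitPrime_subset (hl8 : l % 8 = 5) (hl7 : legendreSym l (-7) = 1) :
    twoIsogenySelmerGroup (-21 * l) (112 * l ^ 2) ⊆ ({1, 7, (l : ℤ) * 1, (l : ℤ) * 2, (l : ℤ) * 7, (l : ℤ) * 14} : Finset ℤ) := by
  have hl : l.Prime := Fact.out
  have hlp : Prime (l : ℤ) := Nat.prime_iff_prime_int.mp hl
  have hl0 : (l : ℤ) ≠ 0 := by exact_mod_cast hl.ne_zero
  have hlpos : (0 : ℤ) < l := by exact_mod_cast hl.pos
  have hb : (112 * l ^ 2 : ℤ) ≠ 0 := mul_ne_zero (by norm_num) (pow_ne_zero 2 hl0)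
  obtain ⟨h14, h8, h56⟩ := not_isSquare_fourteen_eight_fiftysix' hl8 hl7
  have h2 := not_isSquare_two_of_mod_eight' hl8
  intro d hd
  rw [mem_twoIsogenySelmerGroup_iff hb] at hd
  obtain ⟨hsqf, ⟨d', hdd'⟩, hloc⟩ := hd
  have hd'eq : (112 * l ^ 2 : ℤ) / d = d' := by
    rw [hdd', Int.mul_ediv_cancel_left _ hsqf.ne_zero]
  rw [hd'eq] at hloc
  obtain ⟨hreal, hpadic⟩ := hloc
  have hdpos : 0 < d := by
    rcases lt_or_gt_of_ne hsqf.ne_zero with hneg | hpos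
    · exfalso
      have hbpos : (0 : ℤ) < 112 * (l : ℤ) ^ 2 := by positivity
      have hd'neg : d' < 0 := by
        by_contra hcon
        nlinarith [mul_nonpos_iff.mpr (Or.inr ⟨hneg.le, le_of_not_gt hcon⟩)]
      exact not_isSoluble_real_twoIsogenyQuartic_of_neg hneg hd'neg (by linarith) hreal
    · exact hpos
  have hne2 : d ≠ 2 := by
    rintro rfl
    have hd'1 : d' = (l : ℤ) ^ 2 * 56 := by linarith
    exact not_isSoluble_padic_of_nonresidue_of_sq_dvd (p := l) (c := -21) (e' := 56) (by ring)
      hd'1 h2 h56 (hpadic l)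
  have hne14 : d ≠ 14 := by
    rintro rfl
    have hd'1 : d' = (l : ℤ) ^ 2 * 8 := by linarith
    exact not_isSoluble_padic_of_nonresidue_of_sq_dvd (p := l) (c := -21) (e' := 8) (by ring)
      hd'1 h14 h8 (hpadic l)
  have h0 : d ∣ 112 * (l : ℤ) ^ 2 := ⟨d', hdd'⟩
  have h1 : d ∣ (14 * (l : ℤ)) ^ 4 := h0.trans ⟨343 * (l : ℤ) ^ 2, by ring⟩
  have h14l : d ∣ 14 * (l : ℤ) := (hsqf.dvd_pow_iff_dvd (by norm_num)).mp h1
  by_cases hld : (l : ℤ) ∣ d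
  · obtain ⟨e, rfl⟩ := hld
    have he14 : e ∣ 14 := by
      have : (l : ℤ) * e ∣ (l : ℤ) * 14 := by rw [mul_comm (l : ℤ) 14]; exact h14l
      exact (mul_dvd_mul_iff_left hl0).mp this
    have hepos : 0 < e := pos_of_mul_pos_right hdpos hlpos.le
    have hele : e ≤ 14 := Int.le_of_dvd (by norm_num) he14
    interval_cases e <;> first | (exfalso; omega) | simp
  · have hcop : IsCoprime d (l : ℤ) := ((hlp.irreducible.coprime_iff_not_dvd).mpr hld).symm
    have hd14 : d ∣ 14 := hcop.dvd_of_dvd_mul_right h14l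
    have hle : d ≤ 14 := Int.le_of_dvd (by norm_num) hd14
    interval_cases d <;> first | (exfalso; omega) | simp

/-- `E_M(ℚ)_tors = {O, T}` for the two-torsion model `E_M = [0, 21M, 0, 112M², 0]` of `49a1^{(M)}`, `M` squarefree, `M ≢ 1 (mod 4)`, `7 ∤ M`
(`#tors = 2` by c301 gen 11 `torsionOrder_eq_two_of_smul_eq_cm7_quadraticTwist`, and `T = (0,0) ≠ O` is `2`-torsion).
[cite: SilvermanAEC2009, VII.3 and X.5 Cor. 5.4] -/
theorem torsion_twoTorsionModel_cm7 {M : ℤ} (hsq : Squarefree M) (hM4 : M % 4 ≠ 1) (h7 : ¬ (7 : ℤ) ∣ M)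
    [hE : (⟨0, ((21 * M : ℤ) : ℚ), 0, ((112 * M ^ 2 : ℤ) : ℚ), 0⟩ : WeierstrassCurve ℚ).IsElliptic]
    (P : (⟨0, ((21 * M : ℤ) : ℚ), 0, ((112 * M ^ 2 : ℤ) : ℚ), 0⟩ : WeierstrassCurve ℚ).toAffine.Point) (hP : IsOfFinAddOrder P) :
    P = 0 ∨ P = (⟨0, ((21 * M : ℤ) : ℚ), 0, ((112 * M ^ 2 : ℤ) : ℚ), 0⟩ : WeierstrassCurve ℚ).twoTorsionPoint := by
  have hM0 : (M : ℚ) ≠ 0 := by exact_mod_cast hsq.ne_zero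
  haveI := cm7.isElliptic_quadraticTwist hM0
  -- `E_M` is a model of `49a1^{(M)}`: `C₀ • X₀(49)^{(M)} = E_M`
  have hC := smul_eq_twoTorsionModel_of_smul_eq_quadraticTwist M (cm7.quadraticTwist (M : ℚ)) 1 (one_smul _ _)
  rw [mul_one] at hC
  have hC' : (⟨(Units.mk0 (2 : ℚ) two_ne_zero)⁻¹, 2 * (M : ℚ), 0, 0⟩ : VariableChange ℚ)⁻¹ •
      (⟨0, ((21 * M : ℤ) : ℚ), 0, ((112 * M ^ 2 : ℤ) : ℚ), 0⟩ : WeierstrassCurve ℚ) = cm7.quadraticTwist (M : ℚ) := by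
    rw [← hC, inv_smul_smul]
  have htors := torsionOrder_eq_two_of_smul_eq_cm7_quadraticTwist hsq hM4 h7 _ _ hC'
  rw [torsionOrder_eq_natCard_torsion] at htors
  -- the torsion subgroup has exactly two elements, `0` and `T ≠ 0`; so a torsion `P ∉ {0, T}` is impossible
  have hT : (⟨0, ((21 * M : ℤ) : ℚ), 0, ((112 * M ^ 2 : ℤ) : ℚ), 0⟩ : WeierstrassCurve ℚ).twoTorsionPoint ∈
      AddCommGroup.torsion (⟨0, ((21 * M : ℤ) : ℚ), 0, ((112 * M ^ 2 : ℤ) : ℚ), 0⟩ : WeierstrassCurve ℚ).toAffine.Point :=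
    (AddCommGroup.mem_torsion _).mpr (by
      convert isOfFinAddOrder_twoTorsionPoint (⟨0, ((21 * M : ℤ) : ℚ), 0, ((112 * M ^ 2 : ℤ) : ℚ), 0⟩ : WeierstrassCurve ℚ))
  have hT0 := twoTorsionPoint_ne_zero (⟨0, ((21 * M : ℤ) : ℚ), 0, ((112 * M ^ 2 : ℤ) : ℚ), 0⟩ : WeierstrassCurve ℚ)
  have hPmem : P ∈ AddCommGroup.torsion (⟨0, ((21 * M : ℤ) : ℚ), 0, ((112 * M ^ 2 : ℤ) : ℚ), 0⟩ : WeierstrassCurve ℚ).toAffine.Point :=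
    (AddCommGroup.mem_torsion _).mpr hP
  by_contra hne
  push Not at hne
  obtain ⟨z, -, hz⟩ := (Nat.card_eq_two_iff' (⟨0, AddSubgroup.zero_mem _⟩ :
    AddCommGroup.torsion (⟨0, ((21 * M : ℤ) : ℚ), 0, ((112 * M ^ 2 : ℤ) : ℚ), 0⟩ : WeierstrassCurve ℚ).toAffine.Point)).mp (by convert htors)
  have h1 := hz ⟨_, hT⟩ (fun h ↦ hT0 (congrArg Subtype.val h))
  have h2 := hz ⟨P, hPmem⟩ (fun h ↦ hne.1 (congrArg Subtype.val h))
  exact hne.2 (congrArg Subtype.val (h2.trans h1.symm))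

end SelmerTorsion

/-! ## §4 Arithmetic of the index `2|M|` -/

section Index

/-- `ord₂(2·|M|) = 3 ⟺ M = 4m` with `m` odd (`M ≠ 0`). [folklore] -/
theorem padicValNat_two_natAbs_mul_two_eq_three_iff {M : ℤ} (hM : M ≠ 0) :
    padicValNat 2 (M.natAbs * 2) = 3 ↔ ∃ m : ℤ, Odd m ∧ M = 4 * m := by
  haveI : Fact (Nat.Prime 2) := ⟨Nat.prime_two⟩
  have hM' : M.natAbs ≠ 0 := Int.natAbs_ne_zero.mpr hM
  rw [padicValNat.mul hM' two_ne_zero, padicValNat.self (by norm_num)]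
  constructor
  · intro h
    have h2 : padicValNat 2 M.natAbs = 2 := by omega
    have hdvd : 2 ^ 2 ∣ M.natAbs := by have := pow_padicValNat_dvd (p := 2) (n := M.natAbs); rwa [h2] at this
    have hndvd : ¬ 2 ^ 3 ∣ M.natAbs := fun h8 ↦ by
      have := (padicValNat_dvd_iff_le hM').mp h8; omega
    obtain ⟨m, hm⟩ : (4 : ℤ) ∣ M := by
      exact_mod_cast Int.ofNat_dvd_left.mpr hdvd
    refine ⟨m, ?_, hm⟩
    rw [← Int.not_even_iff_odd]
    rintro ⟨k, rfl⟩
    apply hndvd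
    have : (8 : ℤ) ∣ M := ⟨k, by rw [hm]; ring⟩
    exact Int.ofNat_dvd_left.mp (by exact_mod_cast this)
  · rintro ⟨m, hm, rfl⟩
    have hm0 : m ≠ 0 := by rintro rfl; simp at hm
    rw [Int.natAbs_mul, show (4 : ℤ).natAbs = 2 ^ 2 by rfl, padicValNat.mul (by norm_num) (Int.natAbs_ne_zero.mpr hm0),
      padicValNat.prime_pow, padicValNat.eq_zero_of_not_dvd]
    intro h2
    have : (2 : ℤ) ∣ m := by exact_mod_cast Int.ofNat_dvd_left.mpr h2
    exact (Int.not_even_iff_odd.mpr hm) (even_iff_two_dvd.mpr this)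

end Index

end Summit.BirchSwinnertonDyer.BirchSwinnertonDyer.Theorems.GoldfeldGoodTwists

end
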